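import Literature.Analysis.FluidPDE.SereginSverakPressureProofs

set_option linter.dupNamespace false

/-!
# The gauged pressure of the item's solution on backward cylinders at the blow-up time

Item `TerminalTrace.TypeITraceScarL3` (stmt-NavierStokesRegularity-18385) quantifies over a CLASSICAL
pressure `p` on `[0,T) × ℝ³`, which the Navier–Stokes system determines only up to a function of
time `c(t)`; `c` may leave every `L^{3/2}` class near the blow-up time `T`.  The class-restricted
cases of the item landed by nsreg-p2's plates t32/t33/t34 (`typeITraceScarL3_of_localWeakL3Bounded`,
`typeITraceScarL3_of_localWeakL3Slices`, `typeITraceScarL3_unitViscosity_of_layerDecay`) therefore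
kept the printed pressure class `p ∈ L^{3/2}(Q_R(T,x₀))` as an explicit clause.  This file
discharges it: with Tao's gauge `c(t) = p(t,0) − p̃[u(t)](0)` (Tao 2013, Lemma 4.1 (i), proved in
the tree as `tao_pressure_normalisation_holds`; packaged for classical Leray–Hopf solutions on
`[0,T)` in `SereginSverak2002.exists_pressure_gauge_of_classical`), the gauged pressure
`q = p − c` makes `(u, q)` a suitable weak solution on every backward cylinder `Q_R(T,x₀)` with
`R² ≤ T` (`SereginSverak2002.isSuitableWeakSolutionOn_gauge_of_classical`) and lies in
`L^{3/2}(Q_R(T,x₀))` (`SereginSverak2002.lintegral_slab_gauged_pressure_lt_top`: `q(t,·) = p̃[u(t)]`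
for a.e. `t`, Stein's bound slice-wise, `u ∈ L³` of the slab from the Leray–Hopf class).  No Type-I
hypothesis is needed.  Sequel files re-prove the three plates with the clause removed.
-/

noncomputable section

open MeasureTheory Set Function Metric Filter Topology Literature.Analysis.FluidPDE
open scoped ENNReal NNReal

namespace Summit.NavierStokesRegularity.NavierStokesRegularity.Theorems.TypeITraceScarL3

/-- A backward cylinder `Q_R(T,x₀)` with `R² ≤ T` lies in the open slab `(0,T) × ℝ³`. [folklore] -/
theorem parabolicCylinder_top_subset_openSlab {T R : ℝ} (hRT : R ^ 2 ≤ T)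
    (x₀ : EuclideanSpace ℝ (Fin 3)) :
    parabolicCylinder R ((T, x₀) : ℝ × EuclideanSpace ℝ (Fin 3)) ⊆
      Ioo 0 T ×ˢ (univ : Set (EuclideanSpace ℝ (Fin 3))) := by
  intro z hz
  rw [mem_parabolicCylinder] at hz
  refine mem_prod.2 ⟨⟨?_, hz.1.2⟩, mem_univ _⟩
  have h1 : T - R ^ 2 < z.1 := hz.1.1
  linarith

/-- **The gauged pressure on a backward cylinder at the blow-up time.**  For a classical solution
`(u,p)` on `[0,T)` which is Leray–Hopf on `[0,T)`, the gauged pressure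
`q(t,x) = p(t,x) − (p(t,0) − p̃[u(t)](0))` satisfies, on every backward cylinder `Q_R(T,x₀)` with
`0 < R`, `R² ≤ T`: `(u, q)` is a suitable weak solution on `Q_R(T,x₀)` and `q ∈ L^{3/2}(Q_R(T,x₀))`
(Bochner class `MemLp`).  [cite: Tao2011, Lemma 4.1 (i); CaffarelliKohnNirenberg1982, §2 (2.2)–(2.5)] -/
theorem gaugedPressure_suitable_and_memLp {ν T : ℝ} (hν : 0 < ν) (hT : 0 < T)
    {u : ℝ → EuclideanSpace ℝ (Fin 3) → EuclideanSpace ℝ (Fin 3)}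
    {p : ℝ → EuclideanSpace ℝ (Fin 3) → ℝ}
    (hcl : IsClassicalNSSolutionOn (Ico 0 T) ν 0 u p) (hLH : IsLerayHopfOn T ν 0 (u 0) u)
    (x₀ : EuclideanSpace ℝ (Fin 3)) {R : ℝ} (hRT : R ^ 2 ≤ T) :
    IsSuitableWeakSolutionOn (parabolicCylinderOpens R ((T, x₀) : ℝ × EuclideanSpace ℝ (Fin 3))) ν 0 u
        (fun t x => p t x - (p t 0 - normalisedPressure (u t) 0)) ∧
      MemLp (uncurry fun t x => p t x - (p t 0 - normalisedPressure (u t) 0)) (3 / 2)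
        (volume.restrict (parabolicCylinder R ((T, x₀) : ℝ × EuclideanSpace ℝ (Fin 3)))) := by
  have hsub := parabolicCylinder_top_subset_openSlab hRT x₀
  -- suitability on the cylinder (gauge lemma of the tree, on any open region below `T`)
  have hsw : IsSuitableWeakSolutionOn
      (parabolicCylinderOpens R ((T, x₀) : ℝ × EuclideanSpace ℝ (Fin 3))) ν 0 u
      (fun t x => p t x - (p t 0 - normalisedPressure (u t) 0)) :=
    SereginSverak2002.isSuitableWeakSolutionOn_gauge_of_classical hν hT hcl hLH _
      (by rw [coe_parabolicCylinderOpens]; exact hsub)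
  refine ⟨hsw, ?_, ?_⟩
  · -- measurability from the local integrability of the pressure of a suitable weak solution
    have hli := hsw.distributional.2.2.1
    rw [coe_parabolicCylinderOpens] at hli
    exact hli.aestronglyMeasurable
  · -- `∫∫_{Q_R} |q|^{3/2} ≤ ∫∫_{(0,T)×ℝ³} |q|^{3/2} < ∞`
    have h32 : ((3 : ℝ≥0∞) / 2) ≠ 0 := by norm_num
    have h32' : ((3 : ℝ≥0∞) / 2) ≠ ⊤ := ENNReal.div_ne_top (by norm_num) (by norm_num)
    have htoReal : ((3 : ℝ≥0∞) / 2).toReal = (3 / 2 : ℝ) := by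
      rw [ENNReal.toReal_div]; norm_num
    rw [eLpNorm_lt_top_iff_lintegral_rpow_enorm_lt_top h32 h32', htoReal]
    have hslab := SereginSverak2002.lintegral_slab_gauged_pressure_lt_top hν hT hcl hLH
    refine lt_of_le_of_lt ?_ hslab
    exact lintegral_mono_set hsub

/-- **The CKN pressure quantity of the gauged pressure is finite** on `Q_R(T,x₀)`, `0 < R`,
`R² ≤ T`: `D(R; (T,x₀); q) = R⁻² ∫∫_{Q_R} |q|^{3/2} < ∞`. [cite: CaffarelliKohnNirenberg1982, §2 (2.3)] -/
theorem cknD_gaugedPressure_lt_top {ν T : ℝ} (hν : 0 < ν) (hT : 0 < T)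
    {u : ℝ → EuclideanSpace ℝ (Fin 3) → EuclideanSpace ℝ (Fin 3)}
    {p : ℝ → EuclideanSpace ℝ (Fin 3) → ℝ}
    (hcl : IsClassicalNSSolutionOn (Ico 0 T) ν 0 u p) (hLH : IsLerayHopfOn T ν 0 (u 0) u)
    (x₀ : EuclideanSpace ℝ (Fin 3)) {R : ℝ} (hR : 0 < R) (hRT : R ^ 2 ≤ T) :
    cknD R ((T, x₀) : ℝ × EuclideanSpace ℝ (Fin 3))
        (fun t x => p t x - (p t 0 - normalisedPressure (u t) 0)) < ⊤ := by
  have hsub := parabolicCylinder_top_subset_openSlab hRT x₀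
  rw [cknD]
  refine ENNReal.mul_lt_top
    (ENNReal.inv_lt_top.2 (ENNReal.pow_pos (ENNReal.ofReal_pos.2 hR) _)) ?_
  have hslab := SereginSverak2002.lintegral_slab_gauged_pressure_lt_top hν hT hcl hLH
  exact lt_of_le_of_lt (lintegral_mono_set hsub) hslab

end Summit.NavierStokesRegularity.NavierStokesRegularity.Theorems.TypeITraceScarL3

end
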